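import Literature.MathematicalPhysics.QuantumLattice.FermionGibbsVariationalPrinciple
import Literature.MathematicalPhysics.QuantumLattice.VariationalEquilibriumCoexistence
import Literature.MathematicalPhysics.QuantumLattice.InfVolFermionStateWeakLimits
import Literature.MathematicalPhysics.QuantumLattice.GibbsVariationalPrincipleWitness
import HarnessLib

/-!
# VARIATIONAL EQUILIBRIUM STATES EXIST: upper semicontinuity of the mean entropy under weak-⋆ limits, and a maximiser of
# `s̄(ω) − β e_Ψ(ω)` for every lattice-fermion interaction at every temperature

Topic `Literature/MathematicalPhysics/QuantumLattice` (family `hubbard`; crew hubbard-fast S2 «T > 0 / families of models»). The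
variational pressure `P(β,Ψ) = sup_{ω TI} [s̄(ω) − βe_Ψ(ω)]` (`TIVariationalPressure`) is a supremum; all tangent / Griffiths / coexistence
statements of the tree were therefore written for `IsVarEquilibrium` states (maximisers) OR for ε-approximate maximisers, with the honest caveat
that exact maximisers had not been constructed for general models. This file constructs them (Bratteli–Robinson II Prop. 6.2.38 (u.s.c. of
the mean entropy) + Thm. 6.2.40; Araki–Moriya §10–§12 for the Fermion algebra):

* §1 **finite-box entropies are weak-⋆ upper semicontinuous** (`eventually_vonNeumannEntropy_rdm_le_add`): if `ω_j → ω` on every local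
  observable then `S(ω_j|_Λ) ≤ S(ω|_Λ) + ε` eventually — from the variational characterisation `S(ρ) = inf_G [Re tr(ρG) + log Tr e^{−G}]`
  (`GibbsVariationalPrincipleWitness`: an infimum of weak-⋆ CONTINUOUS affine functionals), no Fannes inequality needed;
* §2 **the mean entropy is upper semicontinuous along translation-invariant sequences** (`eventually_entropyDensitySup_le_add`):
  `s̄ = inf_m S_m/m^d` (`TIStateMeanEntropy`) is an infimum of u.s.c. functionals;
* §3 **EXISTENCE** (`FermionInteraction.exists_isVarEquilibrium`): for EVERY interaction `Ψ`, range parameter `R`, real `β` and `d ≥ 1` there is a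
  translation-invariant state with `s̄(ω) − βe_Ψ(ω) = P(β,Ψ,R)` (maximising sequence, weak-⋆ compactness `exists_tendsto_expect_subseq`, §2, continuity of
  the mean energy); weak-⋆ limits of equilibrium states are equilibrium states (`isVarEquilibrium_of_tendsto_expect`);
* §4 with the variational principle (`FermionGibbsVariationalPrinciple`): for every Hermitian even translation-covariant finite-range `Ψ` and `β ≥ 0`
  there is a translation-invariant state with `s̄(ω) − βe_Ψ(ω) = P_free(β,Ψ)` — THERMODYNAMIC-LIMIT GIBBS EQUILIBRIUM STATES EXIST for every
  such model (`exists_entropyDensitySup_sub_mul_eq_freePressure`), and at linear-family couplings their conjugate densities obey the exact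
  Griffiths windows (no `ε`).

Everything is PROVED; no definition, no named fact, no number. HONEST SCOPE: existence only (no uniqueness — phase coexistence is allowed and is
the subject of `VariationalEquilibriumCoexistence`); no KMS / Gibbs-condition characterisation of the maximisers is claimed here.

## Tree / Mathlib search

REUSED: `exists_tendsto_expect_subseq`, `isTranslationInvariant_of_tendsto_expect`, `tendsto_meanEnergy_of_tendsto_expect` (`InfVolFermionStateWeakLimits`);
`Matrix.exists_isHermitian_witness_le_vonNeumannEntropy_add`, `Matrix.vonNeumannEntropy_le_witness` (`GibbsVariationalPrincipleWitness`);
`IsTranslationInvariant.entropyDensitySup_le_boxEntropyDensity`, `…tendsto_boxEntropyDensity` (`TIStateMeanEntropy`); `varPressure`, `sub_mul_le_varPressure`,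
`exists_lt_sub_mul_of_lt_varPressure`, `IsVarEquilibrium` (`TIVariationalPressure`); `varPressure_eq_freePressure` (`FermionGibbsVariationalPrinciple`);
`trace_rdm_mul`, `rdm_posSemidef`, `trace_rdm`. `lean search 'exists_isVarEquilibrium|upper semicontin.*entropy'` (2026-08-28): nothing.

## References

* O. Bratteli, D. W. Robinson, *OAQSM 2* (1997), Prop. 6.2.38 (mean entropy is affine and upper semicontinuous) and Thm. 6.2.40 (existence of
  equilibrium states as tangent functionals / maximisers). [cite: BratteliRobinsonII1997, Thm. 6.2.40]
* H. Araki, H. Moriya, Rev. Math. Phys. 15 (2003) 93, §10 (mean entropy: u.s.c.), §12 (variational principle and its solutions).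
  [cite: ArakiMoriya2003, Theorem 3.8 and §10]
* R. B. Israel, *Convexity in the Theory of Lattice Gases* (1979), Thm. I.2.4 / §II.3. [cite: Israel1979, Thm. I.2.4]
-/

noncomputable section

open scoped ComplexOrder BigOperators
open Finset Literature.InformationTheory.Entropy

namespace Literature.MathematicalPhysics.QuantumLattice

open Matrix HubbardWave0 Literature.Probability.LatticeModels ThermodynamicLimit
open _root_.Filter
open scoped _root_.Topology

namespace InfVolFermionState

variable {d : ℕ} {ωs : ℕ → InfVolFermionState d} {ωl : InfVolFermionState d}

/-! ### §1. Box entropies are weak-⋆ upper semicontinuous -/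

/-- **Upper semicontinuity of the finite-box entropies**: if `ω_j → ω` on every local observable then for every region `Λ` and `ε > 0`,
eventually `S(ω_j|_Λ) ≤ S(ω|_Λ) + ε` (a near-optimal Hermitian witness `G` for `ω|_Λ`: `S(ω_j|_Λ) ≤ Re ω_j(G) + log Tr e^{−G} → Re ω(G) + log Tr e^{−G} ≤ S(ω|_Λ) + ε/2`).
[cite: BratteliRobinsonII1997, Thm. 6.2.40] [cite: NielsenChuang2010, §11.3 eq. (11.40)] -/
theorem eventually_vonNeumannEntropy_rdm_le_add
    (hlim : ∀ (Λ : Finset (Site d)) (A : FermionOp Λ), Tendsto (fun j => (ωs j).expect Λ A) atTop (𝓝 (ωl.expect Λ A)))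
    (Λ : Finset (Site d)) {ε : ℝ} (hε : 0 < ε) :
    ∀ᶠ j in atTop, vonNeumannEntropy ((ωs j).rdm Λ) ≤ vonNeumannEntropy (ωl.rdm Λ) + ε := by
  obtain ⟨G, hG, hle⟩ := Matrix.exists_isHermitian_witness_le_vonNeumannEntropy_add (ωl.rdm_posSemidef Λ) (ωl.trace_rdm Λ)
    (half_pos hε)
  rw [ωl.trace_rdm_mul] at hle
  have hconv : Tendsto (fun j => ((ωs j).expect Λ G).re) atTop (𝓝 ((ωl.expect Λ G).re)) :=
    (Complex.continuous_re.tendsto _).comp (hlim Λ G)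
  filter_upwards [(tendsto_order.1 hconv).2 _ (lt_add_of_pos_right _ (half_pos hε))] with j hj
  have hw := Matrix.vonNeumannEntropy_le_witness ((ωs j).rdm_posSemidef Λ) ((ωs j).trace_rdm Λ) hG
  rw [(ωs j).trace_rdm_mul] at hw
  linarith

/-- `limsup` form: along a weak-⋆ convergent sequence no box entropy exceeds its limit value by a fixed amount infinitely often — stated as
`∀ ε > 0, eventually S(ω_j|_Λ)/|Λ|-free ≤ …`; per-volume version for boxes. [cite: BratteliRobinsonII1997, Thm. 6.2.40] -/
theorem eventually_boxEntropyDensity_le_add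
    (hlim : ∀ (Λ : Finset (Site d)) (A : FermionOp Λ), Tendsto (fun j => (ωs j).expect Λ A) atTop (𝓝 (ωl.expect Λ A)))
    (m : ℕ) {ε : ℝ} (hε : 0 < ε) :
    ∀ᶠ j in atTop, (ωs j).boxEntropyDensity m ≤ ωl.boxEntropyDensity m + ε := by
  rcases Nat.eq_zero_or_pos m with rfl | hm
  · -- `m = 0`: both sides are `S(·|∅)/0^d`; for `d = 0` this is a genuine box, handled by the general lemma with the factor `1`
    filter_upwards [eventually_vonNeumannEntropy_rdm_le_add hlim (halfOpenBox d 0) hε] with j hj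
    rw [boxEntropyDensity_apply, boxEntropyDensity_apply]
    rcases Nat.eq_zero_or_pos d with rfl | hd
    · simp only [pow_zero, div_one]; exact hj
    · simp [zero_pow (ne_of_gt hd)]; exact hε.le
  · have hmd : (0 : ℝ) < (m : ℝ) ^ d := by positivity
    filter_upwards [eventually_vonNeumannEntropy_rdm_le_add hlim (halfOpenBox d m) (mul_pos hε hmd)] with j hj
    rw [boxEntropyDensity_apply, boxEntropyDensity_apply, div_add' _ _ _ hmd.ne', div_le_div_iff_of_pos_right hmd]
    linarith

/-! ### §2. The mean entropy is upper semicontinuous along translation-invariant sequences -/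

/-- **UPPER SEMICONTINUITY OF THE MEAN ENTROPY** (Bratteli–Robinson II Prop. 6.2.38 for the CAR algebra): if translation-invariant states
`ω_j` converge on every local observable to `ω` (`d ≥ 1`), then for every `ε > 0` eventually `s̄(ω_j) ≤ s̄(ω) + ε`.
[cite: BratteliRobinsonII1997, Thm. 6.2.40] [cite: ArakiMoriya2003, Theorem 3.8 and §10] -/
theorem eventually_entropyDensitySup_le_add (hd : 0 < d)
    (hlim : ∀ (Λ : Finset (Site d)) (A : FermionOp Λ), Tendsto (fun j => (ωs j).expect Λ A) atTop (𝓝 (ωl.expect Λ A)))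
    (hTI : ∀ j, (ωs j).IsTranslationInvariant) {ε : ℝ} (hε : 0 < ε) :
    ∀ᶠ j in atTop, (ωs j).entropyDensitySup ≤ ωl.entropyDensitySup + ε := by
  have hl : ωl.IsTranslationInvariant := isTranslationInvariant_of_tendsto_expect hlim hTI
  -- a box on which `ω` nearly attains its mean entropy
  have hbox := (tendsto_order.1 (hl.tendsto_boxEntropyDensity hd)).2 _ (lt_add_of_pos_right _ (half_pos hε))
  obtain ⟨m, hm⟩ := (hbox.and (Filter.eventually_ge_atTop 1)).exists
  filter_upwards [eventually_boxEntropyDensity_le_add hlim m (half_pos hε)] with j hj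
  have h1 := (hTI j).entropyDensitySup_le_boxEntropyDensity hd hm.2
  linarith [hm.1]

/-! ### §3. Existence of equilibrium states; closedness -/

/-- **Weak-⋆ limits of (approximately) maximising translation-invariant sequences are equilibrium states**: if `ω_j` are translation
invariant, `ω_j → ω` locally and `s̄(ω_j) − βe_Ψ(ω_j) → P(β,Ψ,R)`, then `ω` is a variational equilibrium state. [cite: BratteliRobinsonII1997, Thm. 6.2.40] -/
theorem isVarEquilibrium_of_tendsto_expect_of_tendsto (hd : 0 < d) {β : ℝ} {Ψ : FermionInteraction d} {R : ℝ}
    (hlim : ∀ (Λ : Finset (Site d)) (A : FermionOp Λ), Tendsto (fun j => (ωs j).expect Λ A) atTop (𝓝 (ωl.expect Λ A)))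
    (hTI : ∀ j, (ωs j).IsTranslationInvariant)
    (hF : Tendsto (fun j => (ωs j).entropyDensitySup - β * (ωs j).meanEnergy Ψ R) atTop (𝓝 (Ψ.varPressure β R))) :
    ωl.IsVarEquilibrium β Ψ R := by
  have hl : ωl.IsTranslationInvariant := isTranslationInvariant_of_tendsto_expect hlim hTI
  refine ⟨hl, le_antisymm (Ψ.sub_mul_le_varPressure β R hl) ?_⟩
  have he := tendsto_meanEnergy_of_tendsto_expect hlim Ψ R
  refine le_of_forall_pos_le_add fun ε hε => ?_
  -- eventually: `F(ω_j) > P − ε/3`, `s̄(ω_j) ≤ s̄(ω) + ε/3`, `|βe(ω_j) − βe(ω)| < ε/3`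
  have h3 : 0 < ε / 3 := by linarith
  have hβe : Tendsto (fun j => β * (ωs j).meanEnergy Ψ R) atTop (𝓝 (β * ωl.meanEnergy Ψ R)) := he.const_mul β
  have ev1 := (tendsto_order.1 hF).1 _ (sub_lt_self _ h3)
  have ev2 := eventually_entropyDensitySup_le_add hd hlim hTI h3
  have ev3 := (tendsto_order.1 hβe).1 _ (sub_lt_self _ h3)
  obtain ⟨j, ⟨hj1, hj2⟩, hj3⟩ := ((ev1.and ev2).and ev3).exists
  linarith

/-- **Weak-⋆ limits of equilibrium states are equilibrium states** (the set of variational equilibria at `(β,Ψ)` is weak-⋆ sequentially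
closed). [cite: BratteliRobinsonII1997, Thm. 6.2.40] [cite: Israel1979, Thm. I.2.4] -/
theorem isVarEquilibrium_of_tendsto_expect (hd : 0 < d) {β : ℝ} {Ψ : FermionInteraction d} {R : ℝ}
    (hlim : ∀ (Λ : Finset (Site d)) (A : FermionOp Λ), Tendsto (fun j => (ωs j).expect Λ A) atTop (𝓝 (ωl.expect Λ A)))
    (heq : ∀ j, (ωs j).IsVarEquilibrium β Ψ R) : ωl.IsVarEquilibrium β Ψ R := by
  refine isVarEquilibrium_of_tendsto_expect_of_tendsto hd hlim (fun j => (heq j).1) ?_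
  have h : (fun j => (ωs j).entropyDensitySup - β * (ωs j).meanEnergy Ψ R) = fun _ => Ψ.varPressure β R :=
    funext fun j => (heq j).2
  rw [h]
  exact tendsto_const_nhds

end InfVolFermionState

namespace FermionInteraction

variable {d : ℕ}

/-- **VARIATIONAL EQUILIBRIUM STATES EXIST**: for every interaction `Ψ` of the lattice fermions on `ℤ^d` (`d ≥ 1`), every range parameter `R`
and every real `β` there is a translation-invariant state with `s̄(ω) − β e_Ψ(ω) = P(β,Ψ,R)` (a maximising sequence has a weak-⋆ convergent
subsequence; the mean entropy is u.s.c. and the mean energy continuous along it). [cite: BratteliRobinsonII1997, Thm. 6.2.40]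
[cite: ArakiMoriya2003, Theorem 3.8 and §10] -/
theorem exists_isVarEquilibrium (hd : 0 < d) (β : ℝ) (Ψ : FermionInteraction d) (R : ℝ) :
    ∃ ω : InfVolFermionState d, ω.IsVarEquilibrium β Ψ R := by
  -- maximising sequence
  have hseq : ∀ k : ℕ, ∃ ω : InfVolFermionState d, ω.IsTranslationInvariant ∧
      Ψ.varPressure β R - 1 / ((k : ℝ) + 1) < ω.entropyDensitySup - β * ω.meanEnergy Ψ R := fun k =>
    Ψ.exists_lt_sub_mul_of_lt_varPressure β R (sub_lt_self _ (by positivity))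
  choose ωs hTI hlt using hseq
  obtain ⟨φ, hφ, ωl, hlim⟩ := InfVolFermionState.exists_tendsto_expect_subseq ωs
  refine ⟨ωl, InfVolFermionState.isVarEquilibrium_of_tendsto_expect_of_tendsto hd hlim (fun j => hTI (φ j)) ?_⟩
  -- `F(ω_{φ j}) → P`: squeezed between `P − 1/(φ j + 1)` and `P`
  have hlow : Tendsto (fun j => Ψ.varPressure β R - 1 / ((φ j : ℝ) + 1)) atTop (𝓝 (Ψ.varPressure β R)) := by
    have h0 : Tendsto (fun j => 1 / ((φ j : ℝ) + 1)) atTop (𝓝 0) :=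
      (tendsto_one_div_add_atTop_nhds_zero_nat (𝕜 := ℝ)).comp hφ.tendsto_atTop
    have h := (tendsto_const_nhds (x := Ψ.varPressure β R)).sub h0
    rwa [sub_zero] at h
  refine tendsto_of_tendsto_of_tendsto_of_le_of_le hlow tendsto_const_nhds (fun j => (hlt (φ j)).le) fun j =>
    Ψ.sub_mul_le_varPressure β R (hTI (φ j))

/-- **The variational pressure is ATTAINED**: `P(β,Ψ,R) = s̄(ω) − βe_Ψ(ω)` for some translation-invariant `ω` (`d ≥ 1`).
[cite: BratteliRobinsonII1997, Thm. 6.2.40] -/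
theorem exists_entropyDensitySup_sub_mul_eq_varPressure (hd : 0 < d) (β : ℝ) (Ψ : FermionInteraction d) (R : ℝ) :
    ∃ ω : InfVolFermionState d, ω.IsTranslationInvariant ∧ ω.entropyDensitySup - β * ω.meanEnergy Ψ R = Ψ.varPressure β R := by
  obtain ⟨ω, hω⟩ := Ψ.exists_isVarEquilibrium hd β R
  exact ⟨ω, hω.1, hω.2⟩

/-! ### §4. Thermodynamic-limit Gibbs equilibrium states exist for every finite-range model -/

/-- **THERMODYNAMIC-LIMIT EQUILIBRIUM STATES EXIST** for every Hermitian, even, translation-covariant finite-range interaction `Ψ` on `ℤ^d`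
(`d ≥ 1`, `β ≥ 0`): a translation-invariant state `ω` with `s̄(ω) − β e_Ψ(ω) = P_free(β,Ψ) = lim n^{-d} log Re Tr e^{−βH_{[0,n)^d}}`.
[cite: BratteliRobinsonII1997, Thm. 6.2.40] [cite: ArakiMoriya2003, Theorem 3.8 and §10] -/
theorem exists_entropyDensitySup_sub_mul_eq_freePressure (hd : 0 < d) {Ψ : FermionInteraction d} {R : ℝ} (hH : Ψ.IsHermitian)
    (hE : Ψ.IsEven) (hT : Ψ.IsTranslationInvariant) (hR : Ψ.HasFiniteRange R) {β : ℝ} (hβ : 0 ≤ β) :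
    ∃ ω : InfVolFermionState d, ω.IsTranslationInvariant ∧ ω.entropyDensitySup - β * ω.meanEnergy Ψ R = Ψ.freePressure β := by
  rw [← varPressure_eq_freePressure hd hH hE hT hR hβ]
  exact Ψ.exists_entropyDensitySup_sub_mul_eq_varPressure hd β R

/-- At every point of a linear family of couplings an equilibrium state exists, and its conjugate densities obey the EXACT Griffiths window
`(P(θ) − P(θ+δ1_a))/(βδ) ≤ e_a(ω) ≤ (P(θ−δ1_a) − P(θ))/(βδ)` (`β, δ > 0`). [cite: Griffiths1964, Eq. (39) and Fig. 3] [cite: Israel1979, Thm. I.2.4] -/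
theorem exists_isVarEquilibrium_meanEnergy_mem_Icc (hd : 0 < d) {ι : Type*} [Fintype ι] [DecidableEq ι]
    (Ψ₀ : FermionInteraction d) (Ψv : ι → FermionInteraction d) (θ : ι → ℝ) (R : ℝ) {β : ℝ} (hβ : 0 < β) (a : ι) {δ : ℝ} (hδ : 0 < δ) :
    ∃ ω : InfVolFermionState d, ω.IsVarEquilibrium β (linearFamily Ψ₀ Ψv θ) R ∧
      ω.meanEnergy (Ψv a) R ∈ Set.Icc
        (((linearFamily Ψ₀ Ψv θ).varPressure β R - (linearFamily Ψ₀ Ψv (θ + Pi.single a δ)).varPressure β R) / (β * δ))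
        (((linearFamily Ψ₀ Ψv (θ + Pi.single a (-δ))).varPressure β R - (linearFamily Ψ₀ Ψv θ).varPressure β R) / (β * δ)) := by
  obtain ⟨ω, hω⟩ := (linearFamily Ψ₀ Ψv θ).exists_isVarEquilibrium hd β R
  exact ⟨ω, hω, hω.meanEnergy_mem_Icc hβ a hδ⟩

end FermionInteraction

end Literature.MathematicalPhysics.QuantumLattice

end
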